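import Literature.NumberTheory.LFunctions.WooleySimultaneousCongruences
import Literature.NumberTheory.LFunctions.FordVinogradovZRD
import Mathlib.LinearAlgebra.Vandermonde
import HarnessLib

/-!
# The diagonal bound `J_{t,k,h}(ℬ) ≤ (tk)^t |ℬ|^t` via Wooley's theorem

Topic `Literature/NumberTheory/LFunctions`. Everything here is PROVED.

In Ford's §4 (K. Ford, Proc. LMS 85 (2002), proof of Lemma 4.1, case `S₃`, and Lemma 4.2,
`C₁ = k^t`) one needs that for `t = k − h + 1` the incomplete system
`∑_{i≤t} x_i^j = ∑_{i≤t} y_i^j` (`h ≤ j ≤ k`) has at most `c^t` solutions `x` for each fixed `y`.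
Ford quotes Lemma 2.4 (Wooley) for the bound `k!/(h−1)! ≤ k^t`, which counts the solutions
with distinct coordinates (non-singular Jacobian (4.2)); we also account for the coincidence
patterns (at most `t^t` of them, each reduced to a weighted system with distinct coordinates and
non-singular generalized Vandermonde Jacobian), getting the constant `(tk)^t`. This is harmless
downstream (`C₁` only has to be `≤ e^{tE₂}`).

* `FordVK.eval_det_jacPoly_merged` — the Jacobian of `∑_i m_i x_i^{h+j}` (`j < b`) is
  `∏_j (h+j) · ∏_i m_i x_i^{h-1} · det V(x)`;
* `FordVK.card_merged_solutions_le` — at most `∏_{j<b}(h+j)` injective nonzero integer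
  solutions (Wooley with a huge prime);
* `FordVK.card_fiber_le`, `FordVK.Jinc_diag_le` — **`J_{t,k,h}(ℬ) ≤ (tk)^t |ℬ|^t`**.

## References

* K. Ford, Proc. London Math. Soc. (3) 85 (2002), 565–633, (4.2) and proof of Lemma 4.1.
  [Ford2002]
* T. D. Wooley, J. Number Theory 58 (1996), 288–297, Theorem 1. [Wooley1996]
-/

noncomputable section

open Finset MvPolynomial

namespace Literature.NumberTheory.LFunctions
namespace FordVK

open VMV

/-! ### The weighted power-sum system and its Jacobian -/

/-- `F_j = ∑_i m_i X_i^{h+j} − c_j` (`j < b`). [cite: Ford2002, (4.2) (with multiplicities)] -/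
def merged {b : ℕ} (h : ℕ) (m c : Fin b → ℤ) (j : Fin b) : MvPolynomial (Fin b) ℤ :=
  ∑ i, C (m i) * X i ^ (h + j.val) - C (c j)

/-- `deg F_j ≤ h + j`. [folklore] -/
theorem totalDegree_merged_le {b : ℕ} (h : ℕ) (m c : Fin b → ℤ) (j : Fin b) :
    (merged h m c j).totalDegree ≤ h + j.val := by
  unfold merged
  refine (totalDegree_sub _ _).trans (max_le ?_ (by rw [totalDegree_C]; exact Nat.zero_le _))
  refine totalDegree_finsetSum_le fun i _ => ?_
  refine (totalDegree_mul _ _).trans ?_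
  rw [totalDegree_C, zero_add]
  exact (totalDegree_pow _ _).trans (by rw [totalDegree_X]; simp)

/-- `F_j(x) = ∑_i m_i x_i^{h+j} − c_j`. [folklore] -/
theorem eval_merged {b : ℕ} (h : ℕ) (m c : Fin b → ℤ) (j : Fin b) (x : Fin b → ℤ) :
    eval x (merged h m c j) = ∑ i, m i * x i ^ (h + j.val) - c j := by
  simp [merged, map_sum]

/-- `∂F_j/∂x_i (x) = m_i (h+j) x_i^{h+j-1}`. [folklore] -/
theorem eval_pderiv_merged {b : ℕ} (h : ℕ) (m c : Fin b → ℤ) (j i : Fin b) (x : Fin b → ℤ) :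
    eval x (pderiv i (merged h m c j)) = m i * (h + j.val) * x i ^ (h + j.val - 1) := by
  classical
  unfold merged
  rw [map_sub, pderiv_C, sub_zero, map_sum, map_sum]
  rw [Finset.sum_eq_single i]
  · rw [pderiv_C_mul, pderiv_pow, pderiv_X_self, mul_one]
    simp [map_mul, map_pow, map_natCast]
    ring
  · intro i' _ hi'
    rw [pderiv_C_mul, pderiv_pow, pderiv_X_of_ne hi']
    simp
  · intro hi; exact absurd (mem_univ i) hi

/-- **The generalized Vandermonde Jacobian.** For `h ≥ 1`:
`det (∂F_j/∂x_i (x)) = ∏_j (h+j) · ∏_i m_i x_i^{h-1} · det V(x)`, `V` the Vandermonde matrix.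
[cite: Ford2002, (4.2)] -/
theorem eval_det_jacPoly_merged {b : ℕ} {h : ℕ} (hh : 1 ≤ h) (m c : Fin b → ℤ) (x : Fin b → ℤ) :
    eval x (Wooley.jacPoly (merged h m c)).det
      = (∏ j : Fin b, ((h : ℤ) + j.val)) * (Matrix.vandermonde x).det * ∏ i, m i * x i ^ (h - 1) := by
  rw [RingHom.map_det]
  have hM : (RingHom.mapMatrix (eval x)) (Wooley.jacPoly (merged h m c))
      = Matrix.diagonal (fun j : Fin b => ((h : ℤ) + j.val)) * (Matrix.vandermonde x).transpose
          * Matrix.diagonal (fun i => m i * x i ^ (h - 1)) := by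
    ext j i
    rw [Matrix.mul_apply]
    simp only [RingHom.mapMatrix_apply, Matrix.map_apply, Wooley.jacPoly, Matrix.of_apply,
      Matrix.diagonal_mul, Matrix.transpose_apply, Matrix.vandermonde_apply]
    rw [Finset.sum_eq_single i]
    · rw [Matrix.diagonal_apply_eq, eval_pderiv_merged]
      have : x i ^ (h + j.val - 1) = x i ^ j.val * x i ^ (h - 1) := by
        rw [← pow_add]; congr 1; omega
      rw [this]; ring
    · intro i' _ hi'
      rw [Matrix.diagonal_apply_ne _ hi', mul_zero]
    · intro hi; exact absurd (mem_univ i) hi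
  rw [hM, Matrix.det_mul, Matrix.det_mul, Matrix.det_diagonal, Matrix.det_diagonal,
    Matrix.det_transpose]

/-- Non-vanishing of the Jacobian at injective points with nonzero coordinates and weights.
[cite: Ford2002, proof of Lemma 4.1 ("J(x) ≠ 0" off the coincidence locus)] -/
theorem eval_det_jacPoly_merged_ne_zero {b : ℕ} {h : ℕ} (hh : 1 ≤ h) {m : Fin b → ℤ}
    (hm : ∀ i, m i ≠ 0) (c : Fin b → ℤ) {x : Fin b → ℤ} (hx : Function.Injective x)
    (hx0 : ∀ i, x i ≠ 0) : eval x (Wooley.jacPoly (merged h m c)).det ≠ 0 := by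
  rw [eval_det_jacPoly_merged hh]
  refine mul_ne_zero (mul_ne_zero ?_ ?_) ?_
  · exact Finset.prod_ne_zero_iff.2 fun j _ => by
      have : (0 : ℤ) < (h : ℤ) + j.val := by positivity
      exact this.ne'
  · exact Matrix.det_vandermonde_ne_zero_iff.2 hx
  · exact Finset.prod_ne_zero_iff.2 fun i _ => mul_ne_zero (hm i) (pow_ne_zero _ (hx0 i))

/-- **At most `∏_{j<b} (h+j)` injective nonzero integer solutions** of
`∑_i m_i x_i^{h+j} = c_j` (`j < b`), for nonzero weights `m_i` and `h ≥ 1`: Wooley's theorem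
(Ford's Lemma 2.4) modulo a prime exceeding all the data. [cite: Ford2002, Lemma 2.4 and (4.2)] -/
theorem card_merged_solutions_le {b : ℕ} {h : ℕ} (hh : 1 ≤ h) {m : Fin b → ℤ} (hm : ∀ i, m i ≠ 0)
    (c : Fin b → ℤ) (S : Finset (Fin b → ℤ))
    (hS : ∀ v ∈ S, Function.Injective v ∧ (∀ i, v i ≠ 0) ∧
      ∀ j : Fin b, ∑ i, m i * v i ^ (h + j.val) = c j) :
    S.card ≤ ∏ j : Fin b, (h + j.val) := by
  classical
  -- a bound for all coordinates and all Jacobians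
  obtain ⟨N, hN⟩ : ∃ N : ℕ, (∀ v ∈ S, ∀ i, (v i).natAbs < N) ∧
      ∀ v ∈ S, (eval v (Wooley.jacPoly (merged h m c)).det).natAbs < N := by
    refine ⟨(S.sup fun v => (univ.sup fun i => (v i).natAbs) + (eval v (Wooley.jacPoly (merged h m c)).det).natAbs) + 1,
      fun v hv i => ?_, fun v hv => ?_⟩
    · have h1 : (v i).natAbs ≤ univ.sup fun i => (v i).natAbs := Finset.le_sup (f := fun i => (v i).natAbs) (mem_univ i)
      have h2 := Finset.le_sup (f := fun v => (univ.sup fun i => (v i).natAbs)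
        + (eval v (Wooley.jacPoly (merged h m c)).det).natAbs) hv
      omega
    · have h2 := Finset.le_sup (f := fun v => (univ.sup fun i => (v i).natAbs)
        + (eval v (Wooley.jacPoly (merged h m c)).det).natAbs) hv
      omega
  -- a prime `p > 2N`
  obtain ⟨p, hpN, hp⟩ := Nat.exists_infinite_primes (2 * N + 1)
  haveI : Fact p.Prime := ⟨hp⟩
  have hcard := Wooley.card_solutions_le (p := p) (merged h m c) (s := 1) le_rfl S
    (fun v hv j => by
      rw [pow_one, eval_merged, (hS v hv).2.2 j, sub_self]; exact dvd_zero _)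
    (fun v hv hdvd => by
      have hne := eval_det_jacPoly_merged_ne_zero hh hm c (hS v hv).1 (hS v hv).2.1
      refine hne (Int.eq_zero_of_abs_lt_dvd hdvd ?_)
      rw [Int.abs_eq_natAbs, Nat.cast_lt]
      have := (hN.2 v hv)
      omega)
    (fun v hv w hw hvw => by
      funext i
      have hd := hvw i
      rw [pow_one] at hd
      have hsmall : |v i - w i| < (p : ℤ) := by
        have h1 := hN.1 v hv i
        have h2 := hN.1 w hw i
        have h3 := Int.natAbs_sub_le (v i) (w i)
        rw [Int.abs_eq_natAbs, Nat.cast_lt]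
        omega
      exact sub_eq_zero.1 (Int.eq_zero_of_abs_lt_dvd hd hsmall))
  exact hcard.trans (Finset.prod_le_prod' fun j _ => totalDegree_merged_le h m c j)

/-! ### Coincidence patterns of a tuple -/

section Pattern

variable {t : ℕ}

/-- The pattern of `X`: `i ↦` the least index carrying the value `X i`. [folklore] -/
def pat (X : Fin t → ℤ) (i : Fin t) : Fin t :=
  (univ.filter fun i' => X i' = X i).min' ⟨i, by simp⟩

/-- `X (pat X i) = X i`. [folklore] -/
theorem pat_spec (X : Fin t → ℤ) (i : Fin t) : X (pat X i) = X i := by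
  have := Finset.min'_mem (univ.filter fun i' => X i' = X i) ⟨i, by simp⟩
  exact (mem_filter.1 this).2

/-- The pattern only depends on the value. [folklore] -/
theorem pat_congr {X : Fin t → ℤ} {i i' : Fin t} (h : X i = X i') : pat X i = pat X i' := by
  unfold pat
  congr 1
  ext i''
  simp [h]

/-- `pat X` is idempotent. [folklore] -/
theorem pat_pat (X : Fin t → ℤ) (i : Fin t) : pat X (pat X i) = pat X i := pat_congr (pat_spec X i)

/-- Two tuples with the same pattern that agree at the representatives agree everywhere. [folklore] -/
theorem eq_of_pat_eq_of_eq_on {X Y : Fin t → ℤ} (hp : pat X = pat Y)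
    (h : ∀ r, pat X r = r → X r = Y r) : X = Y := by
  funext i
  calc X i = X (pat X i) := (pat_spec X i).symm
    _ = Y (pat X i) := h _ (pat_pat X i)
    _ = Y (pat Y i) := by rw [hp]
    _ = Y i := pat_spec Y i

/-- `X` is injective on its representatives. [folklore] -/
theorem eq_of_rep_of_eq {X : Fin t → ℤ} {r r' : Fin t} (hr : pat X r = r) (hr' : pat X r' = r')
    (h : X r = X r') : r = r' := by
  rw [← hr, ← hr', pat_congr h]

/-- **Grouping a sum over the coordinates by representatives**:
`∑_i f(X_i) = ∑_{r : pat X r = r} #{i : pat X i = r} · f(X_r)`. [folklore] -/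
theorem sum_eq_sum_reps {M : Type*} [AddCommMonoid M] (X : Fin t → ℤ) (f : ℤ → M) :
    ∑ i, f (X i) = ∑ r ∈ univ.filter (fun r => pat X r = r),
      (univ.filter fun i => pat X i = r).card • f (X r) := by
  classical
  have h1 : ∑ i, f (X i) = ∑ i, f (X (pat X i)) := sum_congr rfl fun i _ => by rw [pat_spec X i]
  rw [h1, ← Finset.sum_fiberwise_of_maps_to (g := pat X) (t := univ.filter fun r => pat X r = r)
    (s := univ) (fun i _ => by simp [pat_pat])]
  refine sum_congr rfl fun r _ => ?_
  rw [← Finset.sum_const]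
  refine sum_congr rfl fun i hi => ?_
  rw [(mem_filter.1 hi).2]

end Pattern

/-! ### The fibre bound and `J_{t,k,h}(ℬ) ≤ (tk)^t |ℬ|^t` -/

/-- **At most `t^t k^t` tuples `X ∈ ℬ^t` with prescribed power sums `∑_i X_i^j = c_j`
(`h ≤ j ≤ k`, `h + t = k + 1`, `h ≥ 1`, `0 ∉ ℬ`).** [cite: Ford2002, proof of Lemma 4.1
("the number of x … is ≤ k^t", from Lemma 2.4)] -/
theorem card_fiber_le {h t k : ℕ} (hh : 1 ≤ h) (hk : h + t = k + 1) (B : Finset ℤ)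
    (hB : (0 : ℤ) ∉ B) (c : Fin k → ℤ) :
    ((tuples t B).filter fun X => ∀ j : Fin k, h ≤ j.val + 1 → j.val + 1 ≤ k →
        psv k X j = c j).card ≤ t ^ t * k ^ t := by
  classical
  set F := (tuples t B).filter fun X => ∀ j : Fin k, h ≤ j.val + 1 → j.val + 1 ≤ k →
    psv k X j = c j with hF
  -- split according to the pattern
  have hsplit : F.card = ∑ π : Fin t → Fin t, (F.filter fun X => pat X = π).card := by
    rw [← Finset.card_eq_sum_card_fiberwise (f := fun X => pat X) (t := (univ : Finset (Fin t → Fin t)))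
      (fun X _ => mem_univ _)]
  rw [hsplit]
  have hcardfun : (univ : Finset (Fin t → Fin t)).card = t ^ t := by simp
  have hbound : ∀ π : Fin t → Fin t, (F.filter fun X => pat X = π).card ≤ k ^ t := by
    intro π
    set G := F.filter fun X => pat X = π with hG
    -- representatives of the pattern
    set Rep := (univ : Finset (Fin t)).filter fun r => π r = r with hRep
    set b := Rep.card with hb
    have hbt : b ≤ t := by
      rw [hb, hRep]; exact (card_filter_le _ _).trans (by simp)
    have e : Rep ≃ Fin b := Rep.equivFin
    -- weights and targets of the merged system
    set m : Fin b → ℤ := fun l => ((univ.filter fun i => π i = (e.symm l).1).card : ℤ) with hm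
    have hrep : ∀ l : Fin b, π (e.symm l).1 = (e.symm l).1 := fun l =>
      (Finset.mem_filter.1 (e.symm l).2).2
    have hm0 : ∀ l, m l ≠ 0 := by
      intro l
      have : (e.symm l).1 ∈ univ.filter fun i => π i = (e.symm l).1 := by
        rw [mem_filter]; exact ⟨mem_univ _, hrep l⟩
      have hpos : 0 < (univ.filter fun i => π i = (e.symm l).1).card := card_pos.2 ⟨_, this⟩
      simp only [hm]; exact_mod_cast hpos.ne'
    have hjlt : ∀ j : Fin b, h + j.val - 1 < k := by intro j; have := j.2; omega
    set d : Fin b → ℤ := fun j => c ⟨h + j.val - 1, hjlt j⟩ with hd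
    -- the restriction map
    set Φ : (Fin t → ℤ) → (Fin b → ℤ) := fun X l => X (e.symm l).1 with hΦ
    have hGmem : ∀ X ∈ G, X ∈ tuples t B ∧ pat X = π ∧
        ∀ j : Fin k, h ≤ j.val + 1 → psv k X j = c j := by
      intro X hX
      rw [hG, mem_filter, hF, mem_filter] at hX
      exact ⟨hX.1.1, hX.2, fun j hj => hX.1.2 j hj (by have := j.2; omega)⟩
    have hinj : Set.InjOn Φ G := by
      intro X hX X' hX' hXX'
      obtain ⟨-, hpX, -⟩ := hGmem X hX
      obtain ⟨-, hpX', -⟩ := hGmem X' hX'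
      refine eq_of_pat_eq_of_eq_on (hpX.trans hpX'.symm) fun r hr => ?_
      have hrRep : r ∈ Rep := by rw [hRep, mem_filter]; exact ⟨mem_univ _, by rw [← hpX]; exact hr⟩
      have := congr_fun hXX' (e ⟨r, hrRep⟩)
      simpa [hΦ] using this
    rw [← Finset.card_image_of_injOn hinj]
    -- the image solves the merged system injectively with nonzero coordinates
    have hS : ∀ v ∈ G.image Φ, Function.Injective v ∧ (∀ l, v l ≠ 0) ∧
        ∀ j : Fin b, ∑ l, m l * v l ^ (h + j.val) = d j := by
      intro v hv
      rw [mem_image] at hv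
      obtain ⟨X, hX, rfl⟩ := hv
      obtain ⟨hXB, hpX, hXc⟩ := hGmem X hX
      refine ⟨?_, ?_, ?_⟩
      · intro l l' hll'
        simp only [hΦ] at hll'
        have hr : pat X (e.symm l).1 = (e.symm l).1 := by rw [hpX]; exact hrep l
        have hr' : pat X (e.symm l').1 = (e.symm l').1 := by rw [hpX]; exact hrep l'
        have := eq_of_rep_of_eq hr hr' hll'
        exact e.symm.injective (Subtype.ext this)
      · intro l
        simp only [hΦ]
        intro h0
        rw [mem_tuples] at hXB
        exact hB (h0 ▸ hXB _)
      · intro j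
        -- `∑_l m_l X(rep_l)^{h+j} = ∑_i X_i^{h+j} = c_{h+j-1}`
        have hsum := sum_eq_sum_reps X (fun x => x ^ (h + j.val))
        rw [hpX] at hsum
        have hpsv : psv k X ⟨h + j.val - 1, hjlt j⟩ = ∑ i, X i ^ (h + j.val) := by
          simp only [psv]
          refine sum_congr rfl fun i _ => ?_
          congr 1; omega
        have hc := hXc ⟨h + j.val - 1, hjlt j⟩ (by simp; omega)
        rw [hpsv, hsum] at hc
        -- reindex the sum over `Fin b` by `Rep`
        rw [Fintype.sum_equiv e.symm (fun l => m l * Φ X l ^ (h + j.val))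
              (fun r : Rep => ((univ.filter fun i => π i = r.1).card : ℤ) * X r.1 ^ (h + j.val))
              (fun l => by simp only [hm, hΦ]),
          Finset.sum_coe_sort Rep (fun r => ((univ.filter fun i => π i = r).card : ℤ) * X r ^ (h + j.val))]
        show _ = c ⟨h + j.val - 1, hjlt j⟩
        rw [← hc]
        exact sum_congr rfl fun r _ => by rw [nsmul_eq_mul]
    refine (card_merged_solutions_le hh hm0 d (G.image Φ) hS).trans ?_
    calc ∏ j : Fin b, (h + j.val) ≤ ∏ _j : Fin b, k :=
          Finset.prod_le_prod' fun j _ => by have := j.2; omega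
      _ = k ^ b := by simp
      _ ≤ k ^ t := by
          rcases Nat.eq_zero_or_pos k with hk0 | hkpos
          · have : t = 0 := by omega
            subst this; simp at hbt; simp [hbt]
          · exact Nat.pow_le_pow_right hkpos hbt
  calc ∑ π : Fin t → Fin t, (F.filter fun X => pat X = π).card
      ≤ ∑ _π : Fin t → Fin t, k ^ t := sum_le_sum fun π _ => hbound π
    _ = t ^ t * k ^ t := by rw [sum_const, smul_eq_mul, hcardfun]

/-- **The diagonal bound `J_{t,k,h}(ℬ) ≤ (tk)^t |ℬ|^t`** for `h + t = k + 1`, `h ≥ 1`, `0 ∉ ℬ`.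
(Ford: `k^t |ℬ|^t`, counting only non-singular solutions.) [cite: Ford2002, proof of Lemma 4.1
(case S₃) and Lemma 4.2 (`C₁`)] -/
theorem Jinc_diag_le {h t k : ℕ} (hh : 1 ≤ h) (hk : h + t = k + 1) (B : Finset ℤ)
    (hB : (0 : ℤ) ∉ B) : Jinc k t B h k ≤ (t * k) ^ t * B.card ^ t := by
  classical
  rw [Jinc_eq_card, card_filter, sum_product_right]
  calc ∑ Y ∈ tuples t B, ∑ X ∈ tuples t B,
        (if ∀ j : Fin k, h ≤ j.val + 1 → j.val + 1 ≤ k →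
          psv k (X, Y).1 j = psv k (X, Y).2 j then 1 else 0)
      = ∑ Y ∈ tuples t B, ((tuples t B).filter fun X => ∀ j : Fin k, h ≤ j.val + 1 →
          j.val + 1 ≤ k → psv k X j = psv k Y j).card := by
        refine sum_congr rfl fun Y _ => ?_
        rw [card_filter]
    _ ≤ ∑ _Y ∈ tuples t B, t ^ t * k ^ t :=
        sum_le_sum fun Y _ => card_fiber_le hh hk B hB (psv k Y)
    _ = (t * k) ^ t * B.card ^ t := by
        rw [sum_const, smul_eq_mul, card_tuples, mul_pow]; ring


end FordVK
end Literature.NumberTheory.LFunctions
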